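import Summits.Ventures.CertifiedManyBodySolver.Observables.StiffnessApexTransportThermalFromGround
import Summits.Ventures.CertifiedManyBodySolver.Observables.StiffnessApexTransportTargetSlot
import HarnessLib

/-!
# Ventures/CertifiedManyBodySolver — Observables/StiffnessApexTransportThermalTargetSlot.lean: the DOPED-BOX station instruments at `T > 0` —
# target-slot / two-END-objective station families (ground states) ⇒ the thermal stiffness leaf on the whole box above the station, at every temperature

HONEST FRAMING: one-sided certified CEILINGS on the THERMAL uniform flux stiffness at ONE inverse temperature, ANY density, from `T = 0` station families read at the
TARGET's slot (the lever-free doped instrument of `StiffnessApexTransportTargetSlot`), by the ground → thermal apex row; conditional BY NAME on the source families;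
entropy price `U_A·2H_b(n/2)/(4β(U_lo − U_A))` priced at the bottom of the worded slab (it diverges at the station itself, so the slab starts at `U_lo > U_A`);
CONTROL / CALIBRATION class; a ceiling never speaks to presence; no phase sentence. Zero compute, no definition, no claim node, no `sorry`.

Cell `pub/hubbard-downfold` (D-0096 (2) «T > 0» leg), seat `hubbard-downfold-unc-2` (`prover-hubbard-downfold-unc-2-g18-0`); the thermal twin of
`Observables/StiffnessApexTransportTargetSlot.lean` §2/§5 (M2(c) / Hg-1201 / NdNiO₂ consumer shapes: `…_on_box_of_apexStation_targetSlot`, `…_twoEndObjectives`).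

* §1 `ObsThermalStiffnessSeqCeilingAtBeta_on_box_of_groundApexStation_targetSlot`: station `U_A > 0`, slab `[p, q] × [U_lo, U_max]` (`q ≤ 0`, `U_A < U_lo`), a ground-state
  orbit-lower family `val σ s` for the slot objective `−X₀(σ, U_A)` on the sources `s ∈ [σ(2 − U_A/U_max), σ]` of every slot `σ ∈ [p, q]`, and ONE constant
  `c ≥ −val σ s + U_A·2H_b(n/2)/(4β(U_lo − U_A))` ⇒ the thermal leaf on the slab;
* §2 `…_twoEndObjectives`: the σ-CHORD of two END-objective families (`−X₀(p)`, `−X₀(q)`, read on `[p(2 − U_A/U_max), q]`) is such a family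
  (`orbitLower_slot_chord_of_two_endObjectives`, any state) ⇒ the thermal leaf on the slab with `c ≥ max chord + price(U_lo)`.

References: D. Ruelle, *Statistical Mechanics* (1969) §2.5 [Ruelle1969]; T. Koma, H. Tasaki, J. Stat. Phys. 76 (1994) 745, §1 [KomaTasaki1994]; D. J. Scalapino, S. R. White,
S.-C. Zhang, PRB 47 (1993) 7995, §II [ScalapinoWhiteZhang1993].
-/

noncomputable section

namespace Summit.Ventures.CertifiedManyBodySolver.Observables

open Filter Topology Matrix Finset
open Literature.MathematicalPhysics.QuantumLattice
open Literature.MathematicalPhysics.QuantumLattice.InfVolFermionState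
open Literature.MathematicalPhysics.QuantumLattice.ThermodynamicLimit
open Literature.MathematicalPhysics.QuantumFieldTheory
open Literature.MathematicalPhysics.StatisticalMechanics
open Literature.MathematicalPhysics.StatisticalMechanics.KosterlitzThouless
open Literature.Probability.LatticeModels
open scoped ComplexConjugate ComplexOrder

section Station

variable {UA Ulo Umax p q n β : ℝ}

/-- **THE DOPED SLAB AT `T > 0` FROM ONE STATION READ AT THE TARGET SLOT.** Station `0 < U_A < U_lo`, slab `[p, q] × [U_lo, U_max]` with `q ≤ 0`, density `0 ≤ n < 2`,
`β > 0`. Hypothesis: for every slot `σ ∈ [p, q]`, every source `s ∈ [σ(2 − U_A/U_max), σ]` and every torus-limit GROUND state at `(s, U_A, n)`,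
`val σ s ≤ |D₄|⁻¹ Σ_γ Re ω_γ(−X₀(σ, U_A))`; and ONE constant with `−val σ s + U_A·(2H_b(n/2)/β)/(U_lo − U_A)/4 ≤ c` on the used pairs. Then
`ObsThermalStiffnessSeqCeilingAtBeta t′ U n β c` at every point of the slab. [cite: KomaTasaki1994, §1] [cite: Ruelle1969, §2.5] [cite: ScalapinoWhiteZhang1993, §II] -/
theorem ObsThermalStiffnessSeqCeilingAtBeta_on_box_of_groundApexStation_targetSlot (hUA : 0 < UA) (hlo : UA < Ulo) (hq : q ≤ 0)
    (hn0 : 0 ≤ n) (hn2 : n < 2) (hβ : 0 < β) (val : ℝ → ℝ → ℝ) (c : ℚ)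
    (h : ∀ σ ∈ Set.Icc p q, ∀ s ∈ Set.Icc (σ * (2 - UA / Umax)) σ,
      ∀ (ω : InfVolFermionState 2) (Ls : ℕ → ℕ) (ψ : ∀ L, Fock (Orb (FermionTorus 2 L))),
      Tendsto Ls atTop atTop →
      (∀ j, IsGroundStateInSector (hubbardTorusTT' (Ls j) 1 s UA) (rectN n (Ls j)) 0 (ψ (Ls j))) →
      (∀ j, star (ψ (Ls j)) ⬝ᵥ ψ (Ls j) = 1) → ω.IsTorusLimitOf ψ Ls →
      val σ s ≤ ((Finset.univ : Finset (DihedralGroup 4)).card : ℝ)⁻¹ * ∑ g ∈ (Finset.univ : Finset (DihedralGroup 4)),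
        (ω.expect (d4ShiftSet g 0 (box 2 7)) (fermionEmbed (PolySite.d4Emb g 0 (box 2 7)) (-oddMomentObsTT σ UA 0))).re)
    (hc : ∀ σ ∈ Set.Icc p q, ∀ s ∈ Set.Icc (σ * (2 - UA / Umax)) σ,
      -val σ s + UA * (2 * Real.binEntropy (n / 2) / β) / (Ulo - UA) / 4 ≤ ((c : ℚ) : ℝ)) :
    ∀ tp ∈ Set.Icc p q, ∀ U ∈ Set.Icc Ulo Umax, ObsThermalStiffnessSeqCeilingAtBeta tp U n β c := by
  intro tp htp U hU
  have hUAU : UA < U := hlo.trans_le hU.1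
  have hUP : 0 < U := hUA.trans hUAU
  have htp0 : tp ≤ 0 := htp.2.trans hq
  have hs : tp * (2 * U - UA) / U ∈ Set.Icc (tp * (2 - UA / Umax)) tp :=
    apexSource_mem_Icc_of_slab (p := tp) (q := tp) hUA hUAU.le hU.2 htp0 ⟨le_rfl, le_rfl⟩
  have hapex : U * (tp * (2 * U - UA) / U) = (2 * U - UA) * tp := by
    rw [mul_div_assoc', mul_div_cancel_left₀ _ hUP.ne']; ring
  have hent : 0 ≤ 2 * Real.binEntropy (n / 2) / β :=
    div_nonneg (mul_nonneg (by norm_num) (Real.binEntropy_nonneg (by linarith) (by linarith))) hβ.le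
  have hprice : UA * (2 * Real.binEntropy (n / 2) / β) / (U - UA) / 4 ≤
      UA * (2 * Real.binEntropy (n / 2) / β) / (Ulo - UA) / 4 :=
    div_le_div_of_nonneg_right
      (div_le_div_of_nonneg_left (mul_nonneg hUA.le hent) (sub_pos.2 hlo) (by linarith [hU.1])) (by norm_num)
  refine ObsThermalStiffnessSeqCeilingAtBeta_of_groundApexSource_floor hn0 hn2 hβ hUA.le hUAU hapex
    (ℓ := 4 * val tp (tp * (2 * U - UA) / U)) (fun ω Ls ψ hLs hψ h1 hω => ?_) c ?_
  · have h' := h tp htp _ hs ω Ls ψ hLs hψ h1 hω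
    rw [orbitMean_re_expect_neg_oddMomentTT_lam_zero hω.isTranslationInvariant] at h'
    linarith
  · have hc' := hc tp htp _ hs
    linarith

/-- **THE DOPED SLAB AT `T > 0` FROM TWO END-OBJECTIVE STATION FAMILIES (no `K₂` input, no hinge).** Station `0 < U_A < U_lo`, slab `[p, q] × [U_lo, U_max]` with
`p < q ≤ 0`, `0 ≤ n < 2`, `β > 0`; two ground-state orbit-lower families on the station segment `[p(2 − U_A/U_max), q]`: `vP s` for `−X₀(p, U_A)` and `vQ s` for
`−X₀(q, U_A)`; ONE constant with `−((q − σ)vP s + (σ − p)vQ s)/(q − p) + U_A·(2H_b(n/2)/β)/(U_lo − U_A)/4 ≤ c` on the used pairs. Then the thermal leaf on the slab.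
[cite: KomaTasaki1994, §1] [cite: Ruelle1969, §2.5] [cite: ScalapinoWhiteZhang1993, §II] -/
theorem ObsThermalStiffnessSeqCeilingAtBeta_on_box_of_groundApexStation_twoEndObjectives (hUA : 0 < UA) (hlo : UA < Ulo)
    (hmax : Ulo ≤ Umax) (hq : q ≤ 0) (hpq : p < q) (hn0 : 0 ≤ n) (hn2 : n < 2) (hβ : 0 < β) (vP vQ : ℝ → ℝ) (c : ℚ)
    (hP : ∀ s ∈ Set.Icc (p * (2 - UA / Umax)) q,
      ∀ (ω : InfVolFermionState 2) (Ls : ℕ → ℕ) (ψ : ∀ L, Fock (Orb (FermionTorus 2 L))),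
      Tendsto Ls atTop atTop →
      (∀ j, IsGroundStateInSector (hubbardTorusTT' (Ls j) 1 s UA) (rectN n (Ls j)) 0 (ψ (Ls j))) →
      (∀ j, star (ψ (Ls j)) ⬝ᵥ ψ (Ls j) = 1) → ω.IsTorusLimitOf ψ Ls →
      vP s ≤ ((Finset.univ : Finset (DihedralGroup 4)).card : ℝ)⁻¹ * ∑ g ∈ (Finset.univ : Finset (DihedralGroup 4)),
        (ω.expect (d4ShiftSet g 0 (box 2 7)) (fermionEmbed (PolySite.d4Emb g 0 (box 2 7)) (-oddMomentObsTT p UA 0))).re)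
    (hQ : ∀ s ∈ Set.Icc (p * (2 - UA / Umax)) q,
      ∀ (ω : InfVolFermionState 2) (Ls : ℕ → ℕ) (ψ : ∀ L, Fock (Orb (FermionTorus 2 L))),
      Tendsto Ls atTop atTop →
      (∀ j, IsGroundStateInSector (hubbardTorusTT' (Ls j) 1 s UA) (rectN n (Ls j)) 0 (ψ (Ls j))) →
      (∀ j, star (ψ (Ls j)) ⬝ᵥ ψ (Ls j) = 1) → ω.IsTorusLimitOf ψ Ls →
      vQ s ≤ ((Finset.univ : Finset (DihedralGroup 4)).card : ℝ)⁻¹ * ∑ g ∈ (Finset.univ : Finset (DihedralGroup 4)),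
        (ω.expect (d4ShiftSet g 0 (box 2 7)) (fermionEmbed (PolySite.d4Emb g 0 (box 2 7)) (-oddMomentObsTT q UA 0))).re)
    (hc : ∀ σ ∈ Set.Icc p q, ∀ s ∈ Set.Icc (σ * (2 - UA / Umax)) σ,
      -((q - σ) / (q - p) * vP s + (σ - p) / (q - p) * vQ s) + UA * (2 * Real.binEntropy (n / 2) / β) / (Ulo - UA) / 4 ≤ ((c : ℚ) : ℝ)) :
    ∀ tp ∈ Set.Icc p q, ∀ U ∈ Set.Icc Ulo Umax, ObsThermalStiffnessSeqCeilingAtBeta tp U n β c := by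
  have hUmax : UA ≤ Umax := (hlo.trans_le hmax).le
  have hf : 0 ≤ 2 - UA / Umax := by
    have : UA / Umax ≤ 1 := (div_le_one (hUA.trans_le hUmax)).2 hUmax
    linarith
  refine ObsThermalStiffnessSeqCeilingAtBeta_on_box_of_groundApexStation_targetSlot hUA hlo hq hn0 hn2 hβ
    (fun σ s => (q - σ) / (q - p) * vP s + (σ - p) / (q - p) * vQ s) c (fun σ hσ s hs ω Ls ψ hLs hψ h1 hω => ?_) hc
  have hseg : s ∈ Set.Icc (p * (2 - UA / Umax)) q :=
    ⟨(mul_le_mul_of_nonneg_right hσ.1 hf).trans hs.1, hs.2.trans hσ.2⟩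
  exact orbitLower_slot_chord_of_two_endObjectives hω.isTranslationInvariant UA hpq hσ (hP s hseg ω Ls ψ hLs hψ h1 hω)
    (hQ s hseg ω Ls ψ hLs hψ h1 hω)

end Station

end Summit.Ventures.CertifiedManyBodySolver.Observables

end
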